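import Mathlib.RingTheory.TensorProduct.Basic
import Mathlib.Algebra.Algebra.Subalgebra.Basic
import HarnessLib

/-!
# Venture HSemireg — the tensor-trick transfer with a formal, killed factor is ONE term

The algebraic skeleton of «LEMMA T» of `widen/W1/SDRFREEDOM-READ-tw2.md` (computation cell
`pub-hsemireg`, squad W1, second-code seat w1-tw-2; the lemma sharpens w1-aut-1's
`SLOT-ORBIT-w1aut1.md` §4 (b′) «per-difference SDR freedom»).

Setting on paper (NOT in this file). In a frame `S ≅ C′ × C` of the slot surface, the Dolbeault
algebra of a line bundle pulled back from `C′` contains the algebraic tensor product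
`A₁ ⊗ A₂` (`A₁` = forms on `C′` with values in the bundle, `A₂` = forms on `C` with trivial
coefficients), and the «tensor trick» equips it with the homotopy `h = h₁ ⊗ 1 + Π₁ ⊗ h₂`
(`Π₁ = i₁ p₁`) and the projector `Π = Π₁ ⊗ Π₂`. A summand of the homological-perturbation formula
for `m_N` is the value of a planar binary tree whose leaves carry harmonic classes, whose vertices
multiply and whose edges carry `h`, `Π` or the identity. LEMMA T: if the harmonic subspace of the
second factor is a SUB-ALGEBRA killed by `h₂` and fixed by `Π₂` (true for the flat Hodge data of an
elliptic curve with trivial coefficients: harmonic = constant-coefficient forms), then on leaves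
`b_j ⊗ c_j` with harmonic `c_j` every tree evaluates to (the same tree in `A₁` on the `b_j`)
`⊗ (c₁ c₂ ⋯ c_N)` — ONE term, at every arity: a «qualifying» surface word is the curve word.

What is recorded here is exactly that statement with the analysis replaced by its algebraic
skeleton (no grading, no Koszul sign — the sign is one `±1` per tree and is bookkept on paper, as
in `UnitContractionTree.lean`):

* `Op`, `PTree` — edge operators (identity ∕ projector ∕ homotopy) and planted planar binary trees
  (every subtree, leaves included, carries the operator of its top edge); `PTree.map`,
  `PTree.eval`, `PTree.leafProd` (the ordered product of the leaf labels);
* `SlotOps R A` — two `R`-linear operators `h`, `P` on an `R`-algebra `A`; `SlotOps.app`;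
* `tensorApp D₁ D₂` — the tensor-trick operators on `A₁ ⊗[R] A₂`:
  identity ↦ identity, `H ↦ map h₁ id + map P₁ h₂`, `P ↦ map P₁ P₂`;
* `tensorApp_tmul` — on a pure tensor `a ⊗ s` with `s` in a subalgebra `S` killed by `h₂` and
  fixed by `P₂`, every tensor-trick operator acts as (the `A₁`-operator on `a`) `⊗ s`;
* `leafProd_coe_mem` — the ordered leaf product of `S`-valued leaves lies in `S`;
* `tensor_trick_one_term` — **LEMMA T**: for every planted tree with leaves `(a_j, s_j)`,
  `s_j ∈ S`, the tensor-trick evaluation of the tree on the pure tensors `a_j ⊗ s_j` equals the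
  `A₁`-evaluation of the same tree on the `a_j`, tensor the ordered product of the `s_j`;
* `tensor_trick_one_term_root` — the same with the root projector applied.

HONEST FRAMING. Finite trees over a tensor product of two abstract algebras with linear operators;
the Lean index of a bookkeeping lemma used in a MODEL-LEVEL pricing argument of the cell. No
category, sheaf, complex, differential form or abelian variety appears; nothing here says that HC,
HC_CM or HC_AV holds, and nothing here is a new case of anything.
-/

open scoped TensorProduct

namespace Summit.Ventures.HSemireg

namespace TensorTrick

/-- The operator carried by an edge of a perturbation tree: identity, the projector `Π = i p`,
or the homotopy `h`. -/
inductive Op : Type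
  | I : Op
  | P : Op
  | H : Op
  deriving DecidableEq

/-- Planted planar binary trees with leaf labels in `α`: every subtree (a leaf or an inner vertex
with its two ordered children) carries the operator of the edge above it. -/
inductive PTree (α : Type*) : Type _
  | leaf : Op → α → PTree α
  | node : Op → PTree α → PTree α → PTree α

namespace PTree

variable {α β : Type*}

/-- Relabel the leaves of a planted tree along `f`, keeping shape and edge operators. -/
def map (f : α → β) : PTree α → PTree β
  | leaf o a => leaf o (f a)
  | node o l r => node o (map f l) (map f r)

/-- Evaluate a planted tree in a multiplicative structure: a leaf is its label with the top-edge
operator applied; an inner vertex multiplies the values of its children (in order) and applies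
its top-edge operator. -/
def eval {A : Type*} [Mul A] (app : Op → A → A) : PTree A → A
  | leaf o a => app o a
  | node o l r => app o (eval app l * eval app r)

/-- The ordered product of the leaf labels of a planted tree (edge operators ignored). -/
def leafProd {A : Type*} [Mul A] : PTree A → A
  | leaf _ a => a
  | node _ l r => leafProd l * leafProd r

/-- `map` on a leaf applies `f` to the leaf label. -/
@[simp] theorem map_leaf (f : α → β) (o : Op) (a : α) : map f (leaf o a) = leaf o (f a) := rfl

/-- `map` on a node maps both subtrees. -/
@[simp] theorem map_node (f : α → β) (o : Op) (l r : PTree α) :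
    map f (node o l r) = node o (map f l) (map f r) := rfl

/-- `eval` on a leaf applies the leaf's operation to its label. -/
@[simp] theorem eval_leaf {A : Type*} [Mul A] (app : Op → A → A) (o : Op) (a : A) :
    eval app (leaf o a) = app o a := rfl

/-- `eval` on a node applies the node's operation to the product of the subtree values. -/
@[simp] theorem eval_node {A : Type*} [Mul A] (app : Op → A → A) (o : Op) (l r : PTree A) :
    eval app (node o l r) = app o (eval app l * eval app r) := rfl

/-- `leafProd` of a leaf is its label. -/
@[simp] theorem leafProd_leaf {A : Type*} [Mul A] (o : Op) (a : A) :
    leafProd (leaf o a) = a := rfl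

/-- `leafProd` of a node is the product of the subtrees' leaf products. -/
@[simp] theorem leafProd_node {A : Type*} [Mul A] (o : Op) (l r : PTree A) :
    leafProd (node o l r) = leafProd l * leafProd r := rfl

end PTree

section Slot

variable (R : Type*) [CommRing R]

/-- The two linear operators of one slot's strong-deformation-retract data that enter a
perturbation tree: the homotopy `h` and the projector `P = i ∘ p`. (No identity between them is
assumed in this file.) -/
structure SlotOps (A : Type*) [Ring A] [Algebra R A] where
  /-- the homotopy -/
  h : A →ₗ[R] A
  /-- the projector onto the harmonic subspace -/
  P : A →ₗ[R] A

variable {R}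
variable {A : Type*} [Ring A] [Algebra R A]

/-- The action of an edge operator through one slot's data. -/
def SlotOps.app (D : SlotOps R A) : Op → A → A
  | Op.I, a => a
  | Op.P, a => D.P a
  | Op.H, a => D.h a

/-- The operation `I` acts as the identity. -/
@[simp] theorem SlotOps.app_I (D : SlotOps R A) (a : A) : D.app Op.I a = a := rfl

/-- The operation `P` acts by the map `D.P`. -/
@[simp] theorem SlotOps.app_P (D : SlotOps R A) (a : A) : D.app Op.P a = D.P a := rfl

/-- The operation `H` acts by the map `D.h`. -/
@[simp] theorem SlotOps.app_H (D : SlotOps R A) (a : A) : D.app Op.H a = D.h a := rfl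

end Slot

section Tensor

variable {R : Type*} [CommRing R]
variable {A₁ : Type*} [Ring A₁] [Algebra R A₁]
variable {A₂ : Type*} [Ring A₂] [Algebra R A₂]

/-- The TENSOR-TRICK edge operators on `A₁ ⊗[R] A₂` built from the two slots' data:
identity ↦ identity, homotopy ↦ `h₁ ⊗ 1 + P₁ ⊗ h₂`, projector ↦ `P₁ ⊗ P₂`. -/
noncomputable def tensorApp (D₁ : SlotOps R A₁) (D₂ : SlotOps R A₂) :
    Op → A₁ ⊗[R] A₂ → A₁ ⊗[R] A₂
  | Op.I, x => x
  | Op.P, x => TensorProduct.map D₁.P D₂.P x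
  | Op.H, x => TensorProduct.map D₁.h LinearMap.id x + TensorProduct.map D₁.P D₂.h x

/-- On a pure tensor `a ⊗ s` whose second factor lies in a subalgebra `S` killed by `h₂` and fixed
by `P₂`, every tensor-trick operator acts as the corresponding `A₁`-operator on `a`, tensor `s`:
the `P₁ ⊗ h₂` summand of the homotopy dies. -/
theorem tensorApp_tmul (D₁ : SlotOps R A₁) (D₂ : SlotOps R A₂) (S : Subalgebra R A₂)
    (hS : ∀ s ∈ S, D₂.h s = 0) (pS : ∀ s ∈ S, D₂.P s = s)
    (o : Op) (a : A₁) {s : A₂} (hs : s ∈ S) :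
    tensorApp D₁ D₂ o (a ⊗ₜ[R] s) = (D₁.app o a) ⊗ₜ[R] s := by
  cases o with
  | I => rfl
  | P => simp [tensorApp, TensorProduct.map_tmul, pS s hs]
  | H => simp [tensorApp, TensorProduct.map_tmul, hS s hs, TensorProduct.tmul_zero]

omit [Ring A₁] [Algebra R A₁] in
/-- The ordered leaf product of a tree whose leaf labels are taken in a subalgebra `S` (and read in
the ambient algebra) lies in `S`. -/
theorem leafProd_coe_mem (S : Subalgebra R A₂) :
    ∀ t : PTree (A₁ × S), (t.map (fun q => (q.2 : A₂))).leafProd ∈ S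
  | PTree.leaf _ q => by simp
  | PTree.node _ l r => by
      rw [PTree.map_node, PTree.leafProd_node]
      exact S.mul_mem (leafProd_coe_mem S l) (leafProd_coe_mem S r)

/-- **LEMMA T** (the tensor-trick transfer with a formal, killed factor is one term). Let `S` be a
subalgebra of the second factor killed by `h₂` and fixed pointwise by `P₂`. For every planted tree
`t` with leaf labels `(a_j, s_j)`, `s_j ∈ S`, the tensor-trick evaluation of `t` on the pure
tensors `a_j ⊗ s_j` (vertices multiply in `A₁ ⊗[R] A₂`, edges carry the tensor-trick operators)
equals the evaluation of the same tree in `A₁` on the labels `a_j` (edges carrying `h₁`, `P₁`,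
identity), tensor the ordered product `s₁ s₂ ⋯ s_N` of the second labels. -/
theorem tensor_trick_one_term (D₁ : SlotOps R A₁) (D₂ : SlotOps R A₂) (S : Subalgebra R A₂)
    (hS : ∀ s ∈ S, D₂.h s = 0) (pS : ∀ s ∈ S, D₂.P s = s) :
    ∀ t : PTree (A₁ × S),
      (t.map (fun q => q.1 ⊗ₜ[R] (q.2 : A₂))).eval (tensorApp D₁ D₂) =
        ((t.map Prod.fst).eval D₁.app) ⊗ₜ[R] (t.map (fun q => (q.2 : A₂))).leafProd
  | PTree.leaf o q => by
      simp only [PTree.map_leaf, PTree.eval_leaf, PTree.leafProd_leaf]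
      exact tensorApp_tmul D₁ D₂ S hS pS o q.1 q.2.2
  | PTree.node o l r => by
      have hl := tensor_trick_one_term D₁ D₂ S hS pS l
      have hr := tensor_trick_one_term D₁ D₂ S hS pS r
      simp only [PTree.map_node, PTree.eval_node, PTree.leafProd_node]
      rw [hl, hr, Algebra.TensorProduct.tmul_mul_tmul]
      exact tensorApp_tmul D₁ D₂ S hS pS o _
        (S.mul_mem (leafProd_coe_mem S l) (leafProd_coe_mem S r))

/-- LEMMA T with the root projector applied (the shape in which a summand of the perturbation
formula is read off: root `p = Π` after the top vertex): the tensor-trick projector of the tree's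
value is (the `A₁`-projector of the `A₁`-value) tensor the ordered product of the second labels. -/
theorem tensor_trick_one_term_root (D₁ : SlotOps R A₁) (D₂ : SlotOps R A₂) (S : Subalgebra R A₂)
    (hS : ∀ s ∈ S, D₂.h s = 0) (pS : ∀ s ∈ S, D₂.P s = s) (t : PTree (A₁ × S)) :
    tensorApp D₁ D₂ Op.P ((t.map (fun q => q.1 ⊗ₜ[R] (q.2 : A₂))).eval (tensorApp D₁ D₂)) =
      (D₁.P ((t.map Prod.fst).eval D₁.app)) ⊗ₜ[R] (t.map (fun q => (q.2 : A₂))).leafProd := by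
  rw [tensor_trick_one_term D₁ D₂ S hS pS t]
  simpa using tensorApp_tmul D₁ D₂ S hS pS Op.P _ (leafProd_coe_mem S t)

end Tensor

end TensorTrick

end Summit.Ventures.HSemireg
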